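import Literature.Computability.AlgebraicComplexity.CircuitArithmetizationExpr
import Literature.Computability.AlgebraicComplexity.DefinableVNP
import Literature.Computability.AlgebraicComplexity.PermanentUniversality
import Literature.Computability.AlgebraicComplexity.RealTauConjectureViaVn
import Literature.Computability.Complexity.CircuitAdderMultiplier
import HarnessLib

/-!
# Tavenas' Cor. 3.37 from BCS Thm. (21.29): the coefficient bits of `V_n` by a circuit, and Valiant's criterion as a formula

Discharge of the named fact `Tavenas2014_cor_3_37` (`RealTauConjectureViaVn.lean`; Tavenas 2014,
Cor. 3.37: the multilinear bit polynomial `h_n` of `V_n = ∑_{i<2^n} 2^{2i(2^n-1-i)} X^i` is a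
projection of `PER_{q(n)}`, `q` p-bounded) from the single named fact `BCS1997_thm_21_29 ℚ`
(Valiant 1979 / BCS 1997, Thm. (21.29): a Boolean sum of permanents with the column property
is one permanent, `char ≠ 2`), and hence

* `not_isPBounded_constantFreeComplexity_perPoly_of_realTauConjecture_of_BCS21_29`:
  the Koiran–Tavenas transfer theorem (Tavenas 2014, Thm. 3.3) GIVEN BCS (21.29) only.

The printed proof of Cor. 3.37 (= Prop. 3.17 for `V_n`, thesis pp. 46 and 54) is: the bit
language `Bit(v) = {(1^n # i, j) : j = 2·2^n i - 2i(i+1)}` is in `P` ⊆ `GapP/poly`; by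
Valiant's criterion (Prop. 3.10) `(h_n) ∈ VNP⁰`; by the `VNP`-completeness of the permanent `h_n`
is a projection of `PER_{q(n)}`. We follow it with everything written out:

1. (`§ circuit`) a `B₂`-circuit of size `n^{O(1)}` on the bits `e` of `i < 2^n` whose wires
   `out l` (`l < 2n + 3`) carry the bits of `2 i (2^n - 1 - i)` (`cktSize_vExpBits`: complement,
   schoolbook multiplier `ArithCkt.cktSize_mulBits`, shift);
2. (`§ witness`) Valiant's criterion for THIS language as an explicit *expression*
   `W_n = VALID(Q)(e, y) · ∏_{i<n} (1 + e_i (x_i - 1)) · ∏_{l<2n+3} (1 + w_l (z_l - 1))`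
   (`witnessE`; `VALID` from `CircuitArithmetizationExpr.lean`, `w_l` the polynomial of the wire
   `out l`) with `∑_{e, y ∈ {0,1}} W_n = h_n` (`bsum_eval_witnessE`: the transcript sum collapses
   `y` to the true transcript, `CircuitArith.eval_validPoly`), `E(W_n) = n^{O(1)}`;
3. (`§ projection`) BCS (21.27) (PROVED in the tree, `BCS1997_thm_21_27_holds`) turns `W_n` into
   a permanent with the column property, BCS (21.29) sums out the Boolean block:
   `h_n = per(A'_n)`, `N' ≤ 10 (2 E(W_n) + 2)` (`isProjection_boolSum_eval`);
4. (`§ assembly`) `h_n` is multilinear and `h_n(X^{2^j}; 2^{2^i}) = V_n` (display (3.1)).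

Because the `VP`-witness is a formula, `VNP = VNP_e` (BCS (21.26)) is not needed; because the
bit language is decided by an explicit circuit, no Boolean complexity class is needed.

## References

* S. Tavenas, *Bornes inférieures et supérieures dans les circuits arithmétiques*, PhD thesis,
  ENS Lyon 2014, Prop. 3.10, Prop. 3.17 (display (3.1)), Lemme 3.36, Cor. 3.37, §2.2 pp. 53–54.
* P. Bürgisser, M. Clausen, M. A. Shokrollahi, *Algebraic Complexity Theory*, Springer 1997,
  Thm. (21.27), Thm. (21.29).
* P. Bürgisser, *Completeness and Reduction in Algebraic Complexity Theory*, Springer 2000,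
  Prop. 2.20 (Valiant's criterion).
* L. G. Valiant, *Completeness classes in algebra*, STOC 1979.
-/

noncomputable section

open MvPolynomial

universe u

namespace Literature.Computability.AlgebraicComplexity

open Complexity Complexity.ArithCkt CircuitArith BoolGadgets DefVNP ArithExpr

namespace TavenasVn

/-! ### § circuit: the bits of `2 i (2^n - 1 - i)` -/

/-- The coefficient-exponent map on bit vectors: bit `l` of `vExp n i = 2 i (2^n - 1 - i)` as a
function of the bits `e` of `i`. [cite: Tavenas2014, §2.2 (Bit(v) ∈ P)] -/
def vExpBits (n R : ℕ) : (Fin n → Bool) → Fin R → Bool :=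
  bitsOf (fun e => vExp n (Nat.ofBits e)) R

/-- Complementing the bits complements the number: `ofBits (¬e) = 2^n - 1 - ofBits e`. [folklore] -/
theorem ofBits_not {n : ℕ} (e : Fin n → Bool) : Nat.ofBits (fun i => !e i) = 2 ^ n - 1 - Nat.ofBits e := by
  have h : Nat.ofBits (fun i => !e i) + Nat.ofBits e = 2 ^ n - 1 := by
    rw [ofBits_eq_sum, ofBits_eq_sum, ← Finset.sum_add_distrib]
    have h1 : ∀ t : Fin n, (!e t).toNat * 2 ^ (t : ℕ) + (e t).toNat * 2 ^ (t : ℕ) = 2 ^ (t : ℕ) := fun t => by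
      cases e t <;> simp
    simp only [h1]
    rw [Fin.sum_univ_eq_sum_range (fun t => 2 ^ t) n, Nat.geomSum_eq le_rfl]
    norm_num
  omega

/-- `vExp` through the multiplier: `vExp n i = 2 · (i · (2^n - 1 - i))` with the second factor
read off the complemented bits. [cite: Tavenas2014, Lemme 3.36] -/
theorem vExp_ofBits {n : ℕ} (e : Fin n → Bool) :
    vExp n (Nat.ofBits e) = 2 * mulVal n (Sum.elim e fun i => !e i) := by
  unfold vExp mulVal
  simp only [Sum.elim_inl, Sum.elim_inr]
  rw [ofBits_not]

/-- Routing of the outputs: position `0` is the constant `0`, position `l + 1 ≤ 2n` is product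
bit `l`, higher positions are `0`. [folklore] -/
def outRoute (n R : ℕ) (l : Fin R) : Unit ⊕ Fin (n + n) :=
  if h : 1 ≤ l.val ∧ l.val - 1 < n + n then Sum.inr ⟨l.val - 1, h.2⟩ else Sum.inl ()

/-- Gate budget of the coefficient-bit circuit. [folklore] -/
def vExpSize (n : ℕ) : ℕ := n + (n * mulStepSize n + 1) + 1

/-- **The coefficient bits of `V_n` by a polynomial-size circuit** ("`Bit(v) ∈ P`", Tavenas 2014,
p. 54): complement the input, multiply, shift. [cite: Tavenas2014, §2.2 (Bit(v) ∈ P)] -/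
theorem cktSize_vExpBits (n R : ℕ) : CktSize B2 (vExpBits n R) (vExpSize n) := by
  -- stage 1: the input and its complement
  have h1 : CktSize B2 (fun e : Fin n → Bool => Sum.elim e fun i => !e i) (0 + Fintype.card (Fin n) * 1) :=
    (CktSize.id B2).pair (CktSize.pi_const fun i => cktSize_not i)
  -- stage 2: the product bits
  have h2 := h1.comp (cktSize_mulBits n)
  -- stage 3: a constant `0` and the routing
  have h3 : CktSize B2 (fun (z : Fin (n + n) → Bool) => Sum.elim (fun (_ : Unit) => false) z) (1 + 0) :=
    (cktSize_const (Fin (n + n)) false).pair (CktSize.id B2)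
  have h4 := ((h2.comp h3).outMap (outRoute n R)).of_le
    (show 0 + Fintype.card (Fin n) * 1 + (n * mulStepSize n + 1) + (1 + 0) ≤ vExpSize n by
      simp [vExpSize])
  refine h4.congr fun e l => ?_
  -- semantics: bit `l` of `2 · P`
  have hP : vExpBits n R e l = (mulVal n (Sum.elim e fun i => !e i) * 2 ^ 1).testBit l := by
    simp only [vExpBits, bitsOf, vExp_ofBits, pow_one, mul_comm]
  rw [hP, Nat.testBit_mul_two_pow]
  unfold outRoute
  by_cases hl : 1 ≤ l.val ∧ l.val - 1 < n + n
  · rw [dif_pos hl, decide_eq_true hl.1]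
    simp only [Sum.elim_inr, Bool.true_and, mulBits, bitsOf]
  · rw [dif_neg hl]
    simp only [Sum.elim_inl]
    rcases Nat.lt_or_ge l.val 1 with h0 | h0
    · rw [decide_eq_false (by omega), Bool.false_and]
    · have hge : n + n ≤ l.val - 1 := by omega
      rw [decide_eq_true h0, Bool.true_and]
      exact (Nat.testBit_lt_two_pow ((mulVal_lt n _).trans_le (Nat.pow_le_pow_right (by norm_num) hge))).symm

/-! ### § circuit as data: a `Circuit` with the output wires -/

/-- The number of `z`-variables (and of `x`-variables): `2n + 3`. [cite: Tavenas2014, Cor. 3.37] -/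
abbrev R (n : ℕ) : ℕ := 2 * n + 3

/-- Existence of the realization (unfolding `CktSize`). [folklore] -/
theorem exists_realizes (n : ℕ) : ∃ gs : List (Gate (Fin n)), ∃ out : Fin (R n) → Fin n ⊕ ℕ,
    gs.length ≤ vExpSize n ∧ GateList.Realizes B2 gs out (vExpBits n (R n)) :=
  cktSize_vExpBits n (R n)

/-- The gate list of the coefficient-bit circuit (chosen). [folklore] -/
def vGates (n : ℕ) : List (Gate (Fin n)) := (exists_realizes n).choose

/-- Its output wires. [folklore] -/
def vOut (n : ℕ) : Fin (R n) → Fin n ⊕ ℕ := (exists_realizes n).choose_spec.choose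

/-- The specification of the chosen realization. [folklore] -/
theorem vGates_spec (n : ℕ) :
    (vGates n).length ≤ vExpSize n ∧ GateList.Realizes B2 (vGates n) (vOut n) (vExpBits n (R n)) :=
  (exists_realizes n).choose_spec.choose_spec

/-- The coefficient-bit circuit as a `Circuit` (output wire: `out 0`, irrelevant). [folklore] -/
def vCirc (n : ℕ) : Circuit (Fin n) where
  gates := vGates n
  output := vOut n ⟨0, by simp⟩
  wf j hj a m ha := (vGates_spec n).2.wf j _ (List.getElem?_eq_getElem hj) a m ha
  wf_output m hm := (vGates_spec n).2.outOK _ m hm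

/-- The circuit is over `B₂`. [folklore] -/
theorem isOver_vCirc (n : ℕ) : (vCirc n).IsOver B2 := (vGates_spec n).2.isOver

/-- Its size is polynomial. [folklore] -/
theorem size_vCirc_le (n : ℕ) : (vCirc n).size ≤ vExpSize n := (vGates_spec n).1

/-- The two wire-value functions of the tree agree. [folklore] -/
theorem wireVal_eq_wireOf {ι : Type*} (x : ι → Bool) (vs : List Bool) (w : ι ⊕ ℕ) :
    wireVal x vs w = GateList.wireOf x vs w := by
  cases w <;> rfl

/-- **Output semantics**: at the true transcript, output wire `l` carries bit `l` of
`vExp n (ofBits e)`. [cite: Tavenas2014, §2.2 (Bit(v) ∈ P)] -/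
theorem bwval_trueTranscript_vOut (n : ℕ) (e : Fin n → Bool) (l : Fin (R n)) :
    bwval e (trueTranscript (vCirc n) e) (vOut n l) = vExpBits n (R n) e l := by
  rw [bwval_eq_wireVal, ofFn_trueTranscript, ← wireVals_eq_transcript, GateList.circuit_wireVals,
    wireVal_eq_wireOf]
  exact (vGates_spec n).2.eval e l

/-! ### § witness: Valiant's criterion for `Bit(v)` as an expression -/

section Witness

variable (k : Type u) [CommRing k]

/-- The `x, z` variables: blocks of size `2n + 3` each. [cite: Tavenas2014, Cor. 3.37] -/
abbrev XZ (n : ℕ) : Type := Fin (R n) ⊕ Fin (R n)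

/-- The Boolean variables: the bits `e` of the exponent `i` and the transcript `y` of the circuit. [cite: Tavenas2014, proof of Prop. 3.17] -/
abbrev BB (n : ℕ) : Type := Fin n ⊕ Fin (vCirc n).size

/-- `x`-index of bit `i < n` (the block has `2n + 3 ≥ n` variables). [folklore] -/
def xIdx {n : ℕ} (i : Fin n) : Fin (R n) := i.castLE (by unfold R; omega)

/-- The factor `1 + e_i (x_i - 1)` of the `x`-selector, as an expression. [cite: Tavenas2014, proof of Prop. 3.17, (3.1)] -/
def xFactorE (n : ℕ) (i : Fin n) : ArithExpr k (XZ n ⊕ BB n) :=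
  add (const 1) (mul (var (Sum.inr (Sum.inl i))) (add (var (Sum.inl (Sum.inl (xIdx i)))) (const (-1))))

/-- The `x`-selector `∏_{i<n} (1 + e_i (x_i - 1))`. [cite: Tavenas2014, proof of Prop. 3.17, (3.1)] -/
def xselE (n : ℕ) : ArithExpr k (XZ n ⊕ BB n) := listProd ((List.finRange n).map (xFactorE k n))

/-- The polynomial `w_l` of output wire `l`, in the Boolean block. [cite: Burgisser2000, proof of Prop. 2.20] -/
def wE (n : ℕ) (l : Fin (R n)) : ArithExpr k (XZ n ⊕ BB n) :=
  (wirePolyE (vCirc n).size (vOut n l)).rename Sum.inr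

/-- The factor `1 + w_l (z_l - 1)` of the `z`-selector. [cite: Tavenas2014, proof of Prop. 3.17, (3.1)] -/
def zFactorE (n : ℕ) (l : Fin (R n)) : ArithExpr k (XZ n ⊕ BB n) :=
  add (const 1) (mul (wE k n l) (add (var (Sum.inl (Sum.inr l))) (const (-1))))

/-- The `z`-selector `∏_{l<2n+3} (1 + w_l (z_l - 1))`. [cite: Tavenas2014, proof of Prop. 3.17, (3.1)] -/
def zselE (n : ℕ) : ArithExpr k (XZ n ⊕ BB n) := listProd ((List.finRange (R n)).map (zFactorE k n))

/-- **The witness expression** `W_n = VALID(Q) · XSEL · ZSEL`. [cite: Tavenas2014, proof of Prop. 3.17] -/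
def witnessE (n : ℕ) : ArithExpr k (XZ n ⊕ BB n) :=
  mul (mul ((validPolyE (vCirc n)).rename Sum.inr) (xselE k n)) (zselE k n)

/-- Size of the witness: linear in `n` and the circuit size. [cite: Tavenas2014, proof of Prop. 3.17] -/
theorem size_witnessE_le (n : ℕ) : (witnessE k n).size ≤ 54 * vExpSize n + 4 * n + 4 * R n + 2 := by
  have hV := (size_validPolyE_le (k := k) (vCirc n)).trans (Nat.mul_le_mul_left 54 (size_vCirc_le n))
  have hX : (xselE k n).size = 4 * n := by
    rw [xselE, size_listProd, List.map_map, List.length_map, List.length_finRange]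
    have : ((List.finRange n).map (ArithExpr.size ∘ xFactorE k n)) = (List.finRange n).map fun _ => 3 :=
      List.map_congr_left fun i _ => rfl
    rw [this, List.map_const', List.sum_replicate, List.length_finRange, smul_eq_mul]; ring
  have hZ : (zselE k n).size = 4 * R n := by
    rw [zselE, size_listProd, List.map_map, List.length_map, List.length_finRange]
    have : ((List.finRange (R n)).map (ArithExpr.size ∘ zFactorE k n)) = (List.finRange (R n)).map fun _ => 3 :=
      List.map_congr_left fun l _ => by simp [zFactorE, wE]
    rw [this, List.map_const', List.sum_replicate, List.length_finRange, smul_eq_mul]; ring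
  simp only [witnessE, size_mul, size_rename]
  omega

/-! ### The bit polynomial `h_n` and the Boolean sum of the witness -/

/-- The selected `x`-monomial `x^{bits e}`. [cite: Tavenas2014, proof of Prop. 3.17, (3.1)] -/
def xselV (n : ℕ) (e : Fin n → Bool) : MvPolynomial (XZ n) k :=
  ∏ i : Fin n, (if e i then X (Sum.inl (xIdx i)) else 1)

/-- The selected `z`-monomial `z^{c}`. [cite: Tavenas2014, proof of Prop. 3.17, (3.1)] -/
def zselV (n : ℕ) (c : Fin (R n) → Bool) : MvPolynomial (XZ n) k :=
  ∏ l : Fin (R n), (if c l then X (Sum.inr l) else 1)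

/-- **The bit polynomial** `h_n = ∑_{i < 2^n} x^{bits i} z^{bits (vExp n i)}` of display (3.1)
for `V_n` (all coefficients of `V_n` are powers of two, so each `i` contributes one monomial). [cite: Tavenas2014, proof of Prop. 3.17, (3.1)] -/
def hV (n : ℕ) : MvPolynomial (XZ n) k :=
  ∑ e : Fin n → Bool, xselV k n e * zselV k n (vExpBits n (R n) e)

variable {k}

/-- The selector factor at a Boolean point: `1 + [b] (P - 1)` is `P` or `1`. [folklore] -/
theorem sel_factor {σ : Type*} (b : Bool) (P : MvPolynomial σ k) :
    1 + C (toK k b) * (P + -1) = if b then P else 1 := by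
  cases b
  · simp
  · rw [toK_true, C_1, one_mul, if_pos rfl]; ring

/-- The `x`-selector under a Boolean substitution. [folklore] -/
theorem aeval_φb_xselE (n : ℕ) (e : BB n → Bool) :
    aeval (φb (k := k) (σ := XZ n) e) (xselE k n).eval = xselV k n (e ∘ Sum.inl) := by
  rw [xselE, eval_listProd, List.map_map, map_list_prod, List.map_map, xselV, Fin.prod_univ_def]
  congr 1
  refine List.map_congr_left fun i _ => ?_
  simp only [Function.comp_apply, xFactorE, ArithExpr.eval_add, ArithExpr.eval_const, ArithExpr.eval_mul,
    ArithExpr.eval_var, map_add, map_mul, aeval_X, φb, Sum.elim_inr, Sum.elim_inl, map_neg, map_one]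
  exact sel_factor (e (Sum.inl i)) (X (Sum.inl (xIdx i)) : MvPolynomial (XZ n) k)

/-- The wire polynomial under a Boolean substitution is the Boolean wire value. [folklore] -/
theorem aeval_φb_wE (n : ℕ) (e : BB n → Bool) (l : Fin (R n)) :
    aeval (φb (k := k) (σ := XZ n) e) (wE k n l).eval = C (toK k (bwval (e ∘ Sum.inl) (e ∘ Sum.inr) (vOut n l))) := by
  rw [wE, ArithExpr.eval_rename, eval_wirePolyE, aeval_φb_rename_inr]
  congr 1
  have : (toK k ∘ e) = bpt k (e ∘ Sum.inl) (e ∘ Sum.inr) := by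
    funext v; cases v <;> rfl
  rw [this, eval_wirePoly]

/-- The `z`-selector under a Boolean substitution. [folklore] -/
theorem aeval_φb_zselE (n : ℕ) (e : BB n → Bool) :
    aeval (φb (k := k) (σ := XZ n) e) (zselE k n).eval =
      zselV k n (fun l => bwval (e ∘ Sum.inl) (e ∘ Sum.inr) (vOut n l)) := by
  rw [zselE, eval_listProd, List.map_map, map_list_prod, List.map_map, zselV, Fin.prod_univ_def]
  congr 1
  refine List.map_congr_left fun l _ => ?_
  simp only [Function.comp_apply, zFactorE, ArithExpr.eval_add, ArithExpr.eval_const, ArithExpr.eval_mul,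
    ArithExpr.eval_var, map_add, map_mul, aeval_φb_wE]
  simp only [aeval_X, φb, Sum.elim_inl, map_neg, map_one]
  exact sel_factor (bwval (e ∘ Sum.inl) (e ∘ Sum.inr) (vOut n l)) (X (Sum.inr l) : MvPolynomial (XZ n) k)

/-- `VALID` under a Boolean substitution is the constant `VALID(e, y)`. [folklore] -/
theorem aeval_φb_validE (n : ℕ) (e : BB n → Bool) :
    aeval (φb (k := k) (σ := XZ n) e) ((validPolyE (k := k) (vCirc n)).rename Sum.inr).eval =
      C (MvPolynomial.eval (bpt k (e ∘ Sum.inl) (e ∘ Sum.inr)) (validPoly (vCirc n))) := by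
  rw [ArithExpr.eval_rename, eval_validPolyE, aeval_φb_rename_inr]
  have : (toK k ∘ e) = bpt k (e ∘ Sum.inl) (e ∘ Sum.inr) := funext fun v => by cases v <;> rfl
  rw [this]

/-- The transcript sum against polynomial weights: `∑_y VALID(b, y) · F(y) = F(true transcript)`. [cite: Burgisser2000, proof of Prop. 2.20] -/
theorem sum_C_eval_validPoly_mul {ι σ : Type*} (Q : Circuit ι) (hQ : Q.IsOver B2) (b : ι → Bool)
    (F : (Fin Q.size → Bool) → MvPolynomial σ k) :
    ∑ y : Fin Q.size → Bool, C (MvPolynomial.eval (bpt k b y) (validPoly Q)) * F y = F (trueTranscript Q b) := by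
  classical
  simp only [eval_validPoly Q hQ b]
  rw [Finset.sum_eq_single (trueTranscript Q b)]
  · rw [decide_eq_true (ofFn_trueTranscript Q b), toK_true, C_1, one_mul]
  · intro y _ hy
    rw [decide_eq_false (fun h => hy ((ofFn_eq_transcript_iff Q b y).1 h)), toK_false, C_0, zero_mul]
  · intro h; exact absurd (Finset.mem_univ _) h

/-- Summing over the Boolean block = summing over the `e`-bits and the transcript. [folklore] -/
theorem sum_BB {A : Type*} [AddCommMonoid A] (n : ℕ) (F : (BB n → Bool) → A) :
    ∑ e : BB n → Bool, F e = ∑ b : Fin n → Bool, ∑ y : Fin (vCirc n).size → Bool, F (Sum.elim b y) := by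
  rw [← Fintype.sum_equiv (Equiv.sumArrowEquivProdArrow _ _ _).symm (fun p => F ((Equiv.sumArrowEquivProdArrow _ _ _).symm p)) F
    (fun _ => rfl), Fintype.sum_prod_type]
  rfl

/-- **Valiant's criterion for `Bit(v)`, as an identity**: the Boolean sum of the witness is the
bit polynomial, `∑_{e, y} W_n(x, z, e, y) = h_n`. [cite: Tavenas2014, Prop. 3.10 and proof of Prop. 3.17] -/
theorem bsum_eval_witnessE (n : ℕ) : bsum (witnessE k n).eval = hV k n := by
  unfold bsum hV
  rw [sum_BB]
  refine Finset.sum_congr rfl fun b _ => ?_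
  have hterm : ∀ y : Fin (vCirc n).size → Bool, aeval (φb (k := k) (σ := XZ n) (Sum.elim b y)) (witnessE k n).eval =
      C (MvPolynomial.eval (bpt k b y) (validPoly (vCirc n))) *
        (xselV k n b * zselV k n (fun l => bwval b y (vOut n l))) := by
    intro y
    rw [witnessE, ArithExpr.eval_mul, ArithExpr.eval_mul, map_mul, map_mul, aeval_φb_validE, aeval_φb_xselE,
      aeval_φb_zselE]
    simp only [Sum.elim_comp_inl, Sum.elim_comp_inr, mul_assoc]
  simp only [hterm]
  rw [sum_C_eval_validPoly_mul (vCirc n) (isOver_vCirc n) b]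
  congr 2
  funext l
  exact bwval_trueTranscript_vOut n b l

/-! ### Multilinearity and the substitution (3.1) -/

/-- `degreeOf` of a selector product: at most one in the selected block's variables, zero elsewhere. [folklore] -/
theorem degreeOf_prod_ite_le {σ ι : Type*} [DecidableEq σ] [Fintype ι] (c : ι → Bool) (v : ι → σ)
    (hv : Function.Injective v) (w : σ) :
    degreeOf w (∏ i : ι, (if c i then (X (v i) : MvPolynomial σ k) else 1)) ≤ if ∃ i, v i = w then 1 else 0 := by
  classical
  refine (degreeOf_prod_le _ _ _).trans ?_
  calc ∑ i, degreeOf w (if c i then (X (v i) : MvPolynomial σ k) else 1)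
      ≤ ∑ i : ι, (if v i = w then 1 else 0) := Finset.sum_le_sum fun i _ => by
        split_ifs with h1 h2 h2
        · subst h2; exact (degreeOf_X_le' _ _).trans (by simp)
        · exact (degreeOf_X_le' _ _).trans (le_of_eq (if_neg fun h => h2 h.symm))
        · rw [degreeOf_one]; exact Nat.zero_le _
        · rw [degreeOf_one]
    _ ≤ if ∃ i, v i = w then 1 else 0 := by
        split_ifs with h
        · obtain ⟨i, hi⟩ := h
          rw [Finset.sum_eq_single i]
          · simp [hi]
          · intro j _ hj
            rw [if_neg]
            intro hj'
            exact hj (hv (hj'.trans hi.symm))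
          · simp
        · rw [Finset.sum_eq_zero]
          intro i _
          rw [if_neg fun hi => h ⟨i, hi⟩]

/-- **`h_n` is multilinear.** [cite: Tavenas2014, proof of Prop. 3.17] -/
theorem hV_multilinear (n : ℕ) : ∀ m ∈ (hV k n).support, ∀ w : XZ n, m w ≤ 1 := by
  classical
  intro m hm w
  revert m
  rw [← degreeOf_le_iff]
  unfold hV
  refine (degreeOf_sum_le _ _ _).trans (Finset.sup_le fun e _ => ?_)
  refine (degreeOf_mul_le _ _ _).trans ?_
  have h1 := degreeOf_prod_ite_le (k := k) e (fun i : Fin n => (Sum.inl (xIdx i) : XZ n))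
    (fun i j hij => by
      simp only [Sum.inl.injEq, xIdx, Fin.castLE, Fin.mk.injEq] at hij
      exact Fin.ext hij) w
  have h2 := degreeOf_prod_ite_le (k := k) (vExpBits n (R n) e) (fun l : Fin (R n) => (Sum.inr l : XZ n))
    Sum.inr_injective w
  unfold xselV zselV
  cases w with
  | inl j =>
    have : ¬ ∃ l : Fin (R n), (Sum.inr l : XZ n) = Sum.inl j := fun ⟨l, hl⟩ => Sum.inr_ne_inl hl
    rw [if_neg this] at h2
    split_ifs at h1 <;> omega
  | inr l =>
    have : ¬ ∃ i : Fin n, (Sum.inl (xIdx i) : XZ n) = Sum.inr l := fun ⟨i, hi⟩ => Sum.inl_ne_inr hi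
    rw [if_neg this] at h1
    split_ifs at h2 <;> omega

/-- `V_n` over any commutative ring, expanded. [cite: Tavenas2014, Lemme 3.36] -/
theorem map_tavenasV' (S : Type*) [CommRing S] (n : ℕ) : (tavenasV n).map (Int.castRingHom S) =
    ∑ i ∈ Finset.range (2 ^ n), Polynomial.C ((2 : S) ^ vExp n i) * Polynomial.X ^ i := by
  unfold tavenasV
  rw [Polynomial.map_sum]
  refine Finset.sum_congr rfl fun i _ => ?_
  rw [Polynomial.map_mul, Polynomial.map_pow, Polynomial.map_X, Polynomial.map_C]
  simp

/-- The `x`-monomial under (3.1) is `X^i`. [cite: Tavenas2014, proof of Prop. 3.17, (3.1)] -/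
theorem aeval_kpSubst_xselV (n : ℕ) (e : Fin n → Bool) :
    aeval (kpSubst (R n) (R n)) (xselV ℚ n e) = (Polynomial.X : Polynomial ℚ) ^ Nat.ofBits e := by
  unfold xselV
  rw [ofBits_eq_sum, map_prod]
  have h : ∀ i : Fin n, aeval (kpSubst (R n) (R n)) (if e i then (X (Sum.inl (xIdx i)) : MvPolynomial (XZ n) ℚ) else 1) =
      (Polynomial.X : Polynomial ℚ) ^ ((e i).toNat * 2 ^ (i : ℕ)) := by
    intro i
    cases e i
    · simp
    · simp [kpSubst, xIdx]
  simp only [h]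
  exact Finset.prod_pow_eq_pow_sum _ _ _

/-- The `z`-monomial under (3.1) is the constant `2^{ofBits c}`. [cite: Tavenas2014, proof of Prop. 3.17, (3.1)] -/
theorem aeval_kpSubst_zselV (n : ℕ) (c : Fin (R n) → Bool) :
    aeval (kpSubst (R n) (R n)) (zselV ℚ n c) = Polynomial.C ((2 : ℚ) ^ Nat.ofBits c) := by
  unfold zselV
  rw [ofBits_eq_sum, map_prod]
  have h : ∀ l : Fin (R n), aeval (kpSubst (R n) (R n)) (if c l then (X (Sum.inr l) : MvPolynomial (XZ n) ℚ) else 1) =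
      Polynomial.C ((2 : ℚ) ^ ((c l).toNat * 2 ^ (l : ℕ))) := by
    intro l
    cases c l
    · simp
    · simp [kpSubst]
  simp only [h]
  rw [← map_prod, Finset.prod_pow_eq_pow_sum]

/-- The exponent fits in the `z`-block: `vExp n i < 2^{2n+3}` for `i < 2^n`. [folklore] -/
theorem vExp_lt_two_pow_R (n : ℕ) (e : Fin n → Bool) : vExp n (Nat.ofBits e) < 2 ^ R n :=
  (vExp_lt n _ (Nat.ofBits_lt_two_pow e)).trans (Nat.pow_lt_pow_right (by norm_num) (by unfold R; omega))

/-- **Display (3.1) for `V_n`**: `h_n(X^{2^0}, …, X^{2^{2n+2}}, 2^{2^0}, …, 2^{2^{2n+2}}) = V_n`. [cite: Tavenas2014, proof of Prop. 3.17, (3.1)] -/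
theorem aeval_kpSubst_hV (n : ℕ) :
    aeval (kpSubst (R n) (R n)) (hV ℚ n) = (tavenasV n).map (Int.castRingHom ℚ) := by
  unfold hV
  rw [map_sum]
  have h1 : ∀ e : Fin n → Bool, aeval (kpSubst (R n) (R n)) (xselV ℚ n e * zselV ℚ n (vExpBits n (R n) e)) =
      Polynomial.C ((2 : ℚ) ^ vExp n (Nat.ofBits e)) * Polynomial.X ^ Nat.ofBits e := by
    intro e
    rw [map_mul, aeval_kpSubst_xselV, aeval_kpSubst_zselV, mul_comm]
    congr 3
    rw [vExpBits, ofBits_bitsOf, Nat.mod_eq_of_lt (vExp_lt_two_pow_R n e)]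
  simp only [h1]
  rw [sum_boolVec_eq_sum_range (fun i => Polynomial.C ((2 : ℚ) ^ vExp n i) * Polynomial.X ^ i), map_tavenasV']

end Witness

/-! ### § projection: from BCS (21.27) and (21.29) -/

/-- **A Boolean sum of an expression is a projection of a permanent of linear size**
(BCS 1997, §21.4, p. 557, the two-step argument of Valiant's completeness proof): by
Thm. (21.27) `val(φ) = per(A)` with `A` of size `2 E(φ) + 2` having the column property, and by
Thm. (21.29) (`char k ≠ 2`) the Boolean sum over the block `Fin t` is `per(A')` with
`N' ≤ 10 (2 E(φ) + 2)`; `per(A')` is a projection of `PER_{N'}`. [cite: BurgisserClausenShokrollahi1997, Thm. (21.29)] -/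
theorem isProjection_boolSum_eval {k : Type} [Field k] (h27 : BCS1997_thm_21_27 k) (h29 : BCS1997_thm_21_29 k)
    (hchar : ringChar k ≠ 2) {σ : Type} {t : ℕ} (φ : ArithExpr k (σ ⊕ Fin t)) :
    ∃ N : ℕ, N ≤ 10 * (2 * φ.size + 2) ∧ IsProjection (boolSum φ.eval) (perPoly (Fin N) k) := by
  obtain ⟨A, hA, hAφ⟩ := h27 φ
  obtain ⟨N', hN', A', hA'⟩ := h29 hchar A hA (by omega)
  refine ⟨N', hN', ?_⟩
  have : boolSum φ.eval = entryPer A' := by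
    rw [← hAφ, boolSum_entryPer, hA']
  rw [this]
  exact isProjection_entryPer_perPoly A'

/-! ### § assembly -/

/-- The witness with its Boolean block renamed to `Fin (n + s)`. [folklore] -/
def witnessFin (n : ℕ) : ArithExpr ℚ (XZ n ⊕ Fin (n + (vCirc n).size)) :=
  (witnessE ℚ n).rename (Sum.map id finSumFinEquiv)

/-- Its Boolean sum (in the library's `boolSum` form) is `h_n`. [cite: Tavenas2014, proof of Prop. 3.17] -/
theorem boolSum_witnessFin (n : ℕ) : boolSum (witnessFin n).eval = hV ℚ n := by
  rw [witnessFin, ArithExpr.eval_rename, boolSum_rename_equiv, bsum_eval_witnessE]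

/-- The size of the renamed witness is p-bounded. [folklore] -/
theorem isPBounded_size_witnessFin : IsPBounded fun n => (witnessFin n).size := by
  have c := fun m : ℕ => IsPBounded.const m
  have hstep : IsPBounded mulStepSize := by
    unfold mulStepSize addSize
    exact IsPBounded.add_holds (IsPBounded.add_holds IsPBounded.id IsPBounded.id)
      (IsPBounded.add_holds (IsPBounded.mul_holds (c 73) (IsPBounded.add_holds IsPBounded.id IsPBounded.id)) (c 1))
  have hsz : IsPBounded vExpSize := by
    unfold vExpSize
    exact IsPBounded.add_holds (IsPBounded.add_holds IsPBounded.id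
      (IsPBounded.add_holds (IsPBounded.mul_holds IsPBounded.id hstep) (c 1))) (c 1)
  have hR : IsPBounded R := IsPBounded.add_holds (IsPBounded.mul_holds (c 2) IsPBounded.id) (c 3)
  refine (IsPBounded.add_holds (IsPBounded.add_holds (IsPBounded.add_holds (IsPBounded.mul_holds (c 54) hsz)
    (IsPBounded.mul_holds (c 4) IsPBounded.id)) (IsPBounded.mul_holds (c 4) hR)) (c 2)).mono fun n => ?_
  rw [witnessFin, size_rename]
  exact size_witnessE_le ℚ n

end TavenasVn

open TavenasVn

/-- **Tavenas' Corollary 3.37 from BCS Thm. (21.29)** (with the tree's PROVED Thm. (21.27)):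
the multilinear bit polynomial `h_n` of `V_n` is the Boolean sum of the explicit polynomial-size
expression `W_n`, hence a projection of `PER_{q(n)}` with `q(n) ≤ 10 (2 E(W_n) + 2)` p-bounded,
and `h_n(X^{2^j}; 2^{2^i}) = V_n`. [cite: Tavenas2014, Cor. 3.37] -/
theorem Tavenas2014_cor_3_37_of_BCS21_29 (h29 : BCS1997_thm_21_29 ℚ) : Tavenas2014_cor_3_37 := by
  have hchar : ringChar ℚ ≠ 2 := by rw [ringChar.eq_zero]; norm_num
  choose N hN hproj using fun n => isProjection_boolSum_eval (BCS1997_thm_21_27_holds ℚ) h29 hchar (witnessFin n)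
  refine ⟨N, ?_, fun n => ⟨hV ℚ n, ?_, hV_multilinear n, aeval_kpSubst_hV n⟩⟩
  · have c := fun m : ℕ => IsPBounded.const m
    exact (IsPBounded.mul_holds (c 10) (IsPBounded.add_holds (IsPBounded.mul_holds (c 2) isPBounded_size_witnessFin)
      (c 2))).mono hN
  · rw [← boolSum_witnessFin]
    exact hproj n

/-- **The Koiran–Tavenas transfer theorem GIVEN BCS Thm. (21.29) alone**: if Boolean sums of
permanents with the column property are permanents of linear size in characteristic `≠ 2`
(Valiant 1979; BCS 1997, Thm. (21.29) — the one remaining named fact), then the real τ-conjecture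
implies that `τ(PER_n)` is not polynomially bounded (Tavenas 2014, Thm. 3.3, via the
`P`-definable family `V_n` of §2.2). [cite: Tavenas2014, Thm. 3.3] -/
theorem not_isPBounded_constantFreeComplexity_perPoly_of_realTauConjecture_of_BCS21_29
    (h29 : BCS1997_thm_21_29 ℚ) : not_isPBounded_constantFreeComplexity_perPoly_of_realTauConjecture :=
  not_isPBounded_constantFreeComplexity_perPoly_of_realTauConjecture_of_cor_3_37 (Tavenas2014_cor_3_37_of_BCS21_29 h29)

end Literature.Computability.AlgebraicComplexity
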